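import Summits.QuantumFields.QCD.Theorems.SmallFieldUltracontractivity.Negative.LoadBearing

/-!
# Tightness lemmas for the crux `SmallFieldUltracontractivity` (stmt-QuantumFields-8871)

Second batch of negative-lane lemmas from the cdisprove seat (work file
`Summits/QuantumFields/QCD/Cruxes/SmallFieldUltracontractivity/Disproof.lean`), all sorry-free:

* **T*T identity** `exp_neg_smul_apply_self_eq_sum_norm_sq`: `exp(-tAᴴA)(i,i) = Σ_j |exp(-(t/2)AᴴA)(i,j)|²`
  — the on-diagonal heat kernel is the squared row norm of the half-time kernel, i.e. the crux's
  `C/t²` diagonal bound is EQUIVALENT to the `ℓ² → ℓ^∞` bound `|(e^{-(t/2)H}f)(x)| ≤ √C t⁻¹ ‖f‖₂`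
  (the "InteriorSupBound"/sup-principle form provers should aim at);
  `norm_sq_exp_neg_smul_apply_le`: every entry is dominated by the diagonal ones (Cauchy–Schwarz),
  so only the `12` diagonal colour–spin entries need proof.
* **Zero modes are fixed by the semigroup** `exp_smul_mulVec_eq_self_of_mulVec_eq_zero` and the
  floor `norm_sq_le_re_exp_apply_self_of_mulVec_eq_zero`: `A v = 0`, `‖v‖₂ = 1` ⇒
  `Re exp(-tAᴴA)(i,i) ≥ |v i|²`.
* **Free zero mode** `wilsonDirac_freeCfg_mulVec_constSpinor`: the constant spinors are exact zero
  modes of the tree's free massless Wilson–Dirac operator on every torus, whence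
  `re_exp_freeCfg_apply_self_ge`: `Re e^{-tH}(x,x)_{aα,aα} ≥ 1/L⁴` for `U ≡ 1`, `m = 0`, all `t`, `L`.
* **Exponent tightness** `not_smallFieldUltracontractivityExp`: for every `δ > 0` the crux with
  `C/t^{2+δ}` in place of `C/t²` is FALSE (free field, `r = L`, `t = L²`, `L → ∞`), so the power `2`
  filed by the planner is the right one and any admissible constant has `C ≥ 1`.

No statement of the route is asserted positively. [folklore]
-/

namespace Summit.QuantumFields.QCD.Theorems.SmallFieldUltracontractivity.Negative

open Literature.MathematicalPhysics.QuantumLattice Literature.MathematicalPhysics.QuantumFieldTheory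
open Literature.Probability.LatticeModels (TorusSite)
open scoped Matrix ComplexConjugate ComplexOrder

noncomputable section

section General

variable {ι : Type*} [Fintype ι] [DecidableEq ι]



omit [DecidableEq ι] in
/-- `-(s) • AᴴA` is Hermitian for real `s`. -/
theorem isHermitian_neg_smul_conjTranspose_mul_self (A : Matrix ι ι ℂ) (s : ℝ) :
    (-(s : ℂ) • (Aᴴ * A)).IsHermitian := by
  have hH : (Aᴴ * A).IsHermitian := (Matrix.posSemidef_conjTranspose_mul_self A).isHermitian
  unfold Matrix.IsHermitian
  rw [Matrix.conjTranspose_smul, hH.eq]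
  congr 1
  simp

/-- The heat kernel `exp(-s·AᴴA)` is Hermitian for real `s`. -/
theorem isHermitian_exp_neg_smul (A : Matrix ι ι ℂ) (s : ℝ) :
    (NormedSpace.exp (-(s : ℂ) • (Aᴴ * A))).IsHermitian :=
  (isHermitian_neg_smul_conjTranspose_mul_self A s).exp

/-- **T*T identity.** The on-diagonal heat-kernel entry is the squared `ℓ²` norm of a row of the
half-time kernel: `exp(-tAᴴA)(i,i) = Σ_j |exp(-(t/2)AᴴA)(i,j)|²`. -/
theorem exp_neg_smul_apply_self_eq_sum_norm_sq (A : Matrix ι ι ℂ) (t : ℝ) (i : ι) :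
    (NormedSpace.exp (-(t : ℂ) • (Aᴴ * A))) i i =
      ∑ j, (((‖(NormedSpace.exp (-((t / 2 : ℝ) : ℂ) • (Aᴴ * A))) i j‖ ^ 2 : ℝ)) : ℂ) := by
  set X : Matrix ι ι ℂ := -((t / 2 : ℝ) : ℂ) • (Aᴴ * A) with hX
  have hsum : -(t : ℂ) • (Aᴴ * A) = X + X := by
    rw [hX, ← add_smul]
    congr 1
    push_cast
    ring
  have hH : (NormedSpace.exp X).IsHermitian := isHermitian_exp_neg_smul A (t / 2)
  rw [hsum, Matrix.exp_add_of_commute X X (Commute.refl X), Matrix.mul_apply]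
  refine Finset.sum_congr rfl fun j _ => ?_
  have hji : (NormedSpace.exp X) j i = star ((NormedSpace.exp X) i j) := by
    conv_lhs => rw [← hH.eq]
    rw [Matrix.conjTranspose_apply]
  rw [hji, Complex.star_def, Complex.mul_conj, Complex.normSq_eq_norm_sq]

/-- **Entries are dominated by the diagonal** (Cauchy–Schwarz on rows of the half-time kernel):
`|exp(-tAᴴA)(i,j)|² ≤ Re exp(-tAᴴA)(i,i) · Re exp(-tAᴴA)(j,j)`. -/
theorem norm_sq_exp_neg_smul_apply_le (A : Matrix ι ι ℂ) (t : ℝ) (i j : ι) :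
    ‖(NormedSpace.exp (-(t : ℂ) • (Aᴴ * A))) i j‖ ^ 2 ≤
      ((NormedSpace.exp (-(t : ℂ) • (Aᴴ * A))) i i).re *
        ((NormedSpace.exp (-(t : ℂ) • (Aᴴ * A))) j j).re := by
  set X : Matrix ι ι ℂ := -((t / 2 : ℝ) : ℂ) • (Aᴴ * A) with hX
  set M : Matrix ι ι ℂ := NormedSpace.exp X with hM
  have hsum : -(t : ℂ) • (Aᴴ * A) = X + X := by
    rw [hX, ← add_smul]
    congr 1
    push_cast
    ring
  have hH : M.IsHermitian := isHermitian_exp_neg_smul A (t / 2)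
  have hii := exp_neg_smul_apply_self_eq_sum_norm_sq A t i
  have hjj := exp_neg_smul_apply_self_eq_sum_norm_sq A t j
  rw [hii, hjj]
  simp only [← hX, ← hM, Complex.ofReal_re, ← Complex.ofReal_sum]
  -- the (i,j) entry
  have hij : (NormedSpace.exp (-(t : ℂ) • (Aᴴ * A))) i j = ∑ k, M i k * star (M j k) := by
    rw [hsum, Matrix.exp_add_of_commute X X (Commute.refl X), Matrix.mul_apply]
    refine Finset.sum_congr rfl fun k _ => ?_
    rw [← hM]
    congr 1
    conv_lhs => rw [← hH.eq]
    rw [Matrix.conjTranspose_apply]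
  rw [hij]
  calc ‖∑ k, M i k * star (M j k)‖ ^ 2 ≤ (∑ k, ‖M i k‖ * ‖M j k‖) ^ 2 := by
        gcongr
        refine (norm_sum_le _ _).trans (le_of_eq ?_)
        refine Finset.sum_congr rfl fun k _ => ?_
        rw [norm_mul, norm_star]
    _ ≤ (∑ k, ‖M i k‖ ^ 2) * ∑ k, ‖M j k‖ ^ 2 :=
        Finset.sum_mul_sq_le_sq_mul_sq _ _ _




section CLM
open scoped Matrix.Norms.L2Operator

/-- `M ↦ M *ᵥ v` as a continuous linear map (finite dimension, `L²`-operator norm on matrices). -/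
def mulVecCLM (v : ι → ℂ) : Matrix ι ι ℂ →L[ℂ] (ι → ℂ) :=
  LinearMap.toContinuousLinearMap
    { toFun := fun M => M *ᵥ v
      map_add' := fun M N => Matrix.add_mulVec M N v
      map_smul' := fun c M => Matrix.smul_mulVec c M v }

omit [DecidableEq ι] in
/-- Values of `mulVecCLM`. -/
@[simp] theorem mulVecCLM_apply (v : ι → ℂ) (M : Matrix ι ι ℂ) : mulVecCLM v M = M *ᵥ v := rfl

/-- **Zero modes are fixed by the semigroup**: if `X v = 0` then `exp(s X) v = v` for real `s`
(the curve `u ↦ exp(uX) v` has derivative `exp(uX) X v = 0`). -/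
theorem exp_smul_mulVec_eq_self_of_mulVec_eq_zero (X : Matrix ι ι ℂ) {v : ι → ℂ}
    (hv : X *ᵥ v = 0) (s : ℝ) : NormedSpace.exp (s • X) *ᵥ v = v := by
  set f : ℝ → (ι → ℂ) := fun u => mulVecCLM v (NormedSpace.exp (u • X)) with hf
  have hd : ∀ u : ℝ, HasDerivAt f 0 u := by
    intro u
    have h := ((mulVecCLM v).restrictScalars ℝ).hasFDerivAt.comp_hasDerivAt u
      (hasDerivAt_exp_smul_const X u)
    have h0 : ((mulVecCLM v).restrictScalars ℝ) (NormedSpace.exp (u • X) * X) = 0 := by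
      rw [ContinuousLinearMap.coe_restrictScalars', mulVecCLM_apply, ← Matrix.mulVec_mulVec, hv,
        Matrix.mulVec_zero]
    rw [h0] at h
    exact h
  have hdiff : Differentiable ℝ f := fun u => (hd u).differentiableAt
  have hconst := is_const_of_deriv_eq_zero hdiff (fun u => (hd u).deriv) s 0
  have hf0 : f 0 = v := by simp [hf]
  have hfs : f s = NormedSpace.exp (s • X) *ᵥ v := rfl
  rw [← hfs, hconst, hf0]

end CLM


/-- Real-scalar form used by the crux: `exp(-(s:ℂ) • H) v = v` if `H v = 0`. -/
theorem exp_neg_smul_mulVec_eq_self_of_mulVec_eq_zero (H : Matrix ι ι ℂ) {v : ι → ℂ}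
    (hv : H *ᵥ v = 0) (s : ℝ) : NormedSpace.exp (-(s : ℂ) • H) *ᵥ v = v := by
  have h := exp_smul_mulVec_eq_self_of_mulVec_eq_zero H hv (-s)
  have e : ((-s : ℝ) • H : Matrix ι ι ℂ) = -(s : ℂ) • H := by
    rw [← Complex.coe_smul]; push_cast; rfl
  rwa [e] at h


end General

/-! ### The free zero mode and exponent tightness -/



/-- The site-constant colour–spin basis spinor `c_{a₀α₀}(y,b,β) = δ_{(b,β),(a₀,α₀)}`. -/
def constSpinor (L : ℕ) (a₀ : Fin 3) (α₀ : Fin 4) : TorusSite 4 L × Fin 3 × Fin 4 → ℂ :=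
  fun q => if q.2 = (a₀, α₀) then 1 else 0

/-- Entries of the free massless Wilson–Dirac operator against the constant spinor, site by site. -/
theorem wilsonDirac_freeCfg_apply_const (L : ℕ) [NeZero L] (p : TorusSite 4 L × Fin 3 × Fin 4)
    (y : TorusSite 4 L) (a₀ : Fin 3) (α₀ : Fin 4) :
    wilsonDirac (fundamentalRep (Fin 3)) (freeCfg L) 0 1 p (y, a₀, α₀) =
      (if p.1 = y then (if p.2 = (a₀, α₀) then (4 : ℂ) else 0) else 0) -
        (1 / 2 : ℂ) * ∑ μ : Fin 4,
          ((if y = Site.shift p.1 μ then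
              (((1 : ℂ) • (1 : Matrix (Fin 4) (Fin 4) ℂ) - euclideanGamma μ) p.2.2 α₀ *
                (1 : Matrix (Fin 3) (Fin 3) ℂ) p.2.1 a₀) else 0) +
           (if y = p.1 - Pi.single μ 1 then
              (((1 : ℂ) • (1 : Matrix (Fin 4) (Fin 4) ℂ) + euclideanGamma μ) p.2.2 α₀ *
                (1 : Matrix (Fin 3) (Fin 3) ℂ) p.2.1 a₀) else 0)) := by
  simp only [wilsonDirac, Matrix.of_apply, map_one, inv_one, Complex.ofReal_one]
  congr 1
  · -- diagonal term
    by_cases h : p.1 = y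
    · by_cases h2 : p.2 = (a₀, α₀)
      · have : p = (y, a₀, α₀) := by ext <;> simp [h, h2]
        simp [this]
      · have : p ≠ (y, a₀, α₀) := by
          rintro rfl; exact h2 rfl
        simp [this, h, h2]
    · have : p ≠ (y, a₀, α₀) := by rintro rfl; exact h rfl
      simp [this, h]
  · congr 1
    refine Finset.sum_congr rfl fun μ _ => ?_
    congr 1
    simp only [eq_shift_iff]

/-- **The constant spinors are zero modes of the free massless Wilson–Dirac operator** on every
periodic torus: `D_W(U ≡ 1, m = 0, r = 1) c_{a₀α₀} = 0` (the `4r` diagonal cancels the eight hops,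
the `γ`-terms cancel pairwise). -/
theorem wilsonDirac_freeCfg_mulVec_constSpinor (L : ℕ) [NeZero L] (a₀ : Fin 3) (α₀ : Fin 4) :
    wilsonDirac (fundamentalRep (Fin 3)) (freeCfg L) 0 1 *ᵥ constSpinor L a₀ α₀ = 0 := by
  ext p
  rw [Matrix.mulVec, dotProduct, Pi.zero_apply]
  simp only [constSpinor, mul_ite, mul_one, mul_zero]
  rw [Fintype.sum_prod_type]
  simp only [Finset.sum_ite_eq', Finset.mem_univ, if_true]
  simp only [wilsonDirac_freeCfg_apply_const]
  rw [Finset.sum_sub_distrib, Finset.sum_ite_eq, ← Finset.mul_sum, Finset.sum_comm]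
  simp only [Finset.mem_univ, if_true, Finset.sum_add_distrib, Finset.sum_ite_eq',
    Finset.mem_univ, if_true]
  rcases p with ⟨x, b, β⟩
  simp only [Matrix.sub_apply, Matrix.add_apply, Matrix.smul_apply, Matrix.one_apply, smul_eq_mul,
    Prod.mk.injEq, Fin.sum_univ_four]
  by_cases hb : b = a₀ <;> by_cases hβ : β = α₀ <;> simp [hb, hβ] <;> ring


/-- `Σ_q ‖c_{a₀α₀}(q)‖² = L⁴` (one unit entry per site). -/
theorem sum_norm_sq_constSpinor (L : ℕ) [NeZero L] (a₀ : Fin 3) (α₀ : Fin 4) :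
    ∑ q, ‖constSpinor L a₀ α₀ q‖ ^ 2 = (L : ℝ) ^ 4 := by
  simp only [constSpinor]
  rw [Fintype.sum_prod_type]
  simp only [apply_ite norm, norm_one, norm_zero, ite_pow, one_pow, ne_eq, OfNat.ofNat_ne_zero,
    not_false_eq_true, zero_pow, Finset.sum_ite_eq', Finset.mem_univ, if_true, Finset.sum_const,
    Finset.card_univ, nsmul_eq_mul, mul_one]
  rw [Fintype.card_fun, ZMod.card, Fintype.card_fin]
  push_cast
  ring

/-- **Zero modes bound the heat kernel from below.** If `A v = 0` and `Σ_j ‖v j‖² = 1` then for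
every real `t`, `‖v i‖² ≤ Re exp(-t·AᴴA)(i,i)` (T*T identity + Cauchy–Schwarz + `exp(-(t/2)AᴴA)v = v`). -/
theorem norm_sq_le_re_exp_apply_self_of_mulVec_eq_zero {ι : Type*} [Fintype ι] [DecidableEq ι]
    (A : Matrix ι ι ℂ) {v : ι → ℂ} (hv : A *ᵥ v = 0) (hv1 : ∑ j, ‖v j‖ ^ 2 = 1) (t : ℝ) (i : ι) :
    ‖v i‖ ^ 2 ≤ ((NormedSpace.exp (-(t : ℂ) • (Aᴴ * A))) i i).re := by
  set M : Matrix ι ι ℂ := NormedSpace.exp (-((t / 2 : ℝ) : ℂ) • (Aᴴ * A)) with hM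
  have hH : (Aᴴ * A) *ᵥ v = 0 := by rw [← Matrix.mulVec_mulVec, hv, Matrix.mulVec_zero]
  have hMv : M *ᵥ v = v := exp_neg_smul_mulVec_eq_self_of_mulVec_eq_zero _ hH (t / 2)
  have hvi : v i = ∑ j, M i j * v j := by
    conv_lhs => rw [← hMv]
    rfl
  rw [exp_neg_smul_apply_self_eq_sum_norm_sq, ← hM, ← Complex.ofReal_sum, Complex.ofReal_re,
    hvi]
  calc ‖∑ j, M i j * v j‖ ^ 2 ≤ (∑ j, ‖M i j‖ * ‖v j‖) ^ 2 := by
        gcongr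
        refine (norm_sum_le _ _).trans (le_of_eq ?_)
        exact Finset.sum_congr rfl fun j _ => norm_mul _ _
    _ ≤ (∑ j, ‖M i j‖ ^ 2) * ∑ j, ‖v j‖ ^ 2 := Finset.sum_mul_sq_le_sq_mul_sq _ _ _
    _ = ∑ j, ‖M i j‖ ^ 2 := by rw [hv1, mul_one]

/-- **Free zero-mode floor.** For `U ≡ 1`, `m = 0`, every `L ≥ 1` and every real `t`:
`Re exp(-t D_Wᴴ D_W)((x,a,α),(x,a,α)) ≥ 1/L⁴` (the normalised constant spinor is a zero mode). -/
theorem re_exp_freeCfg_apply_self_ge (L : ℕ) [NeZero L] (t : ℝ) (x : TorusSite 4 L) (a : Fin 3)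
    (α : Fin 4) :
    1 / (L : ℝ) ^ 4 ≤ ((NormedSpace.exp (-(t : ℂ) • (Matrix.conjTranspose
      (wilsonDirac (fundamentalRep (Fin 3)) (freeCfg L) 0 1) *
        wilsonDirac (fundamentalRep (Fin 3)) (freeCfg L) 0 1))) (x, a, α) (x, a, α)).re := by
  have hL : (0 : ℝ) < (L : ℝ) := by exact_mod_cast Nat.pos_of_ne_zero (NeZero.ne L)
  set v : TorusSite 4 L × Fin 3 × Fin 4 → ℂ := fun q => ((1 / (L : ℝ) ^ 2 : ℝ) : ℂ) * constSpinor L a α q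
    with hvdef
  have hv : wilsonDirac (fundamentalRep (Fin 3)) (freeCfg L) 0 1 *ᵥ v = 0 := by
    have : v = ((1 / (L : ℝ) ^ 2 : ℝ) : ℂ) • constSpinor L a α := by
      funext q; rw [hvdef, Pi.smul_apply, smul_eq_mul]
    rw [this, Matrix.mulVec_smul, wilsonDirac_freeCfg_mulVec_constSpinor, smul_zero]
  have hv1 : ∑ j, ‖v j‖ ^ 2 = 1 := by
    have : ∀ j, ‖v j‖ ^ 2 = (1 / (L : ℝ) ^ 2) ^ 2 * ‖constSpinor L a α j‖ ^ 2 := by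
      intro j
      rw [hvdef, norm_mul, mul_pow, Complex.norm_real, Real.norm_of_nonneg (by positivity)]
    simp_rw [this]
    rw [← Finset.mul_sum, sum_norm_sq_constSpinor]
    field_simp
  have key := norm_sq_le_re_exp_apply_self_of_mulVec_eq_zero _ hv hv1 t (x, a, α)
  have hvx : ‖v (x, a, α)‖ ^ 2 = 1 / (L : ℝ) ^ 4 := by
    rw [hvdef, norm_mul, Complex.norm_real, Real.norm_of_nonneg (by positivity)]
    simp only [constSpinor, if_true, norm_one, mul_one]
    field_simp
  rwa [hvx] at key


/-! ### Exponent tightness: `t⁻²` cannot be improved to `t^{-(2+δ)}` -/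

/-- STRENGTHENING 2 — a better exponent: the crux with `C / t²` replaced by `C / t^{2+δ}`. -/
def SmallFieldUltracontractivityExp (δ : ℝ) : Prop :=
  ∃ ε : ℝ, 0 < ε ∧ ∃ K : ℕ, ∃ C : ℝ, ∀ (L : ℕ) [NeZero L] (U : GaugeConfig 4 L SU3) (m : ℝ),
    m ∈ Set.Icc (-(1 / 2 : ℝ)) 1 → ∀ (x : TorusSite 4 L) (r : ℕ), 1 ≤ r → r ≤ L →
    (∀ y : TorusSite 4 L, torusDist x y ≤ K * r → ∀ μ ν : Fin 4,
      3 - ((fundamentalRep (Fin 3)) (plaquetteHolonomy U y μ ν)).trace.re ≤ (ε / (r : ℝ) ^ 2) ^ 2) →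
    ∀ (t : ℝ), 1 ≤ t → t ≤ (r : ℝ) ^ 2 → ∀ (a b : Fin 3) (α β : Fin 4),
      ‖(NormedSpace.exp (-(t : ℂ) • (Matrix.conjTranspose
        (wilsonDirac (fundamentalRep (Fin 3)) U m 1) * wilsonDirac (fundamentalRep (Fin 3)) U m 1)))
        (x, a, α) (x, b, β)‖ ≤ C / t ^ (2 + δ)

/-- **The exponent `2` is sharp**: for every `δ > 0` the `t^{-(2+δ)}` strengthening of the crux is
false — already for the free field `U ≡ 1`, `m = 0`, at `r = L`, `t = L²`, where the constant zero
mode gives `e^{-tH}(x,x) ≥ 1/L⁴ = 1/t²` for every `L` (`re_exp_freeCfg_apply_self_ge`). -/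
theorem not_smallFieldUltracontractivityExp {δ : ℝ} (hδ : 0 < δ) :
    ¬ SmallFieldUltracontractivityExp δ := by
  rintro ⟨ε, -, K, C, h⟩
  -- Step 1: for every `L ≥ 1`, `((L:ℝ)²)^δ ≤ C`.
  have main : ∀ L : ℕ, 1 ≤ L → ((L : ℝ) ^ 2) ^ δ ≤ C := by
    intro L hL
    haveI : NeZero L := ⟨by omega⟩
    have hL' : (1 : ℝ) ≤ (L : ℝ) := by exact_mod_cast hL
    have hT : (0 : ℝ) < (L : ℝ) ^ 2 := by positivity
    have ht1 : (1 : ℝ) ≤ (L : ℝ) ^ 2 := by nlinarith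
    have key := h L (freeCfg L) 0 (by norm_num) (fun _ => 0) L hL le_rfl
      (smallness_freeCfg L ε K L _) ((L : ℝ) ^ 2) ht1 le_rfl 0 0 0 0
    have low := re_exp_freeCfg_apply_self_ge L ((L : ℝ) ^ 2) (fun _ => 0) 0 0
    have low' : 1 / (L : ℝ) ^ 4 ≤ C / ((L : ℝ) ^ 2) ^ (2 + δ) :=
      low.trans ((Complex.re_le_norm _).trans (by exact_mod_cast key))
    rw [Real.rpow_add hT, Real.rpow_two] at low'
    have hpow : (0 : ℝ) < ((L : ℝ) ^ 2) ^ δ := Real.rpow_pos_of_pos hT δ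
    have h4 : ((L : ℝ) ^ 2) ^ 2 = (L : ℝ) ^ 4 := by ring
    rw [h4, div_le_div_iff₀ (by positivity) (by positivity), one_mul] at low'
    -- low' : L^4 * (L^2)^δ ≤ C * L^4
    have hL4 : (0 : ℝ) < (L : ℝ) ^ 4 := by positivity
    nlinarith
  -- Step 2: pick `L` with `((L:ℝ)²)^δ > max C 1 ≥ C`.
  set y : ℝ := max C 1 with hy
  have hy0 : 0 ≤ y := le_trans zero_le_one (le_max_right _ _)
  set L : ℕ := ⌈y ^ δ⁻¹⌉₊ + 1 with hLdef
  have hL1 : 1 ≤ L := by omega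
  have hLgt : y ^ δ⁻¹ < (L : ℝ) := by
    have := Nat.le_ceil (y ^ δ⁻¹)
    rw [hLdef]; push_cast; linarith
  have hLr : (1 : ℝ) ≤ (L : ℝ) := by exact_mod_cast hL1
  have h1 : y < ((L : ℝ)) ^ δ := by
    calc y = (y ^ δ⁻¹) ^ δ := (Real.rpow_inv_rpow hy0 hδ.ne').symm
      _ < (L : ℝ) ^ δ := Real.rpow_lt_rpow (Real.rpow_nonneg hy0 _) hLgt hδ
  have h2 : (L : ℝ) ^ δ ≤ ((L : ℝ) ^ 2) ^ δ :=
    Real.rpow_le_rpow (by positivity) (by nlinarith) hδ.le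
  have h3 := main L hL1
  have hC : C ≤ y := le_max_left _ _
  linarith


end

end Summit.QuantumFields.QCD.Theorems.SmallFieldUltracontractivity.Negative
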